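import Mathlib
import HarnessLib
import Summits.HubbardSuperconductivity.HubbardSuperconductivity.Theorems.ComplexGFFStiffnessDefs
import Summits.HubbardSuperconductivity.HubbardSuperconductivity.Theorems.ComplexGFFStiffnessHypACumulantPertK
import Summits.HubbardSuperconductivity.HubbardSuperconductivity.Theorems.ComplexGFFStiffnessHypACumulantPertZBasic

/-!
# Crux `HypACumulant`, line `gnv` — the real tilt `t ↦ 𝒦_{g,t} = e^{tQ_u}(1 + 𝒦_g) − 1` and the
# fixed-volume calculus of the second cumulant: `⟨Y_u²⟩_g − ⟨Y_u⟩_g² = d/dt|₀ (M₁(t)/M₀(t))`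

Route `route-HubbardSuperconductivity-ComplexGFFStiffness`, crux item stmt-HubbardSuperconductivity-19154
(`HypACumulant`), registered stub `stub_cumulantGivenZ : CumulantGivenZ` (the `N`-uniform second-cumulant
bound for the tilt response `Y_u`).  This file is the FIXED-VOLUME half of the reduction of that stub to the
`N`-uniform Lipschitz continuity of one-point functions in the perturbation
(`…Theorems.ComplexGFF.OnePointLipschitz`, shared with the sibling crux `HypALocalTwoPoint`):

* `tiltQ u` — the local quadratic form `Q_u(z) = u_0 Σ_{j≥1} z_j² + 2 z_0 Σ_{j≥1} u_j z_j` with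
  `Y_u(φ) = Σ_x Q_u(∇φ(x))` (`Y_eq_sum_tiltQ`);
* `tiltK g u t` — the tilted single-site perturbation `𝒦_{g,t}(z) = exp(−i g 𝒜(z) + t Q_u(z)) − 1`, so that
  `e^{−S_0} ∏_x (1 + 𝒦_{g,t}(∇φ(x))) = w_{g,0} · e^{t Y_u}` (`exp_neg_S_mul_prod_tiltK`) and
  `pertZ n 𝒦_{g,t} = M₀(t)` (`pertZ_tiltK`); `𝒦_{g,0} = 𝒦_g` (`tiltK_zero`), and `𝒦_{g,t}` is `ι`-symmetric
  for real `t` (`tiltK_neg`);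
* `tiltMoment n g u k t = M_k(t) = ∫ w_{g,0} Y_u^k e^{tY_u}` — the moments of the real exponential tilt;
  `M_k` is differentiable on `|t| < 1/(24(‖u‖+1))` with `M_k' = M_{k+1}` (`hasDerivAt_tiltMoment`, dominated
  differentiation: `|Y_u| ≤ 6‖u‖ S_0`), `M_k(0)/Z_n(g,0) = ⟨Y_u^k⟩_g` (`ev_pow_Y_eq`);
* **`hasDerivAt_tiltMean`** — if `Z_n(g,0) ≠ 0` then `t ↦ ⟨Y_u⟩_{g,t} := M₁(t)/M₀(t)` has derivative
  `⟨Y_u²⟩_g − ⟨Y_u⟩_g²` at `t = 0`: the second cumulant is the `t`-derivative of the tilted mean, i.e. of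
  `|Λ|` times a one-point function of the perturbation `𝒦_{g,t}` ([ABKM19] Thm 2.2, `ℓ = 2`, along the real
  tilt; [FisherBarberJasnow1973] (2.4)–(2.5)).

Everything here is finite-dimensional calculus on a fixed torus; nothing uniform in the volume is claimed,
and nothing here bears on the Hubbard model beyond the crux's bookkeeping.  All proved, no `sorry`.

## References
* S. Adams, S. Buchholz, R. Kotecký, S. Müller, arXiv:1910.13564, Sec. 2.1, Theorem 2.2
  [AdamsBuchholzKoteckyMuller2019].
* M. E. Fisher, M. N. Barber, D. Jasnow, Phys. Rev. A 8 (1973) 1111, Sec. II [FisherBarberJasnow1973].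
-/

noncomputable section

-- `Summit.<Summit>.<Problem>`: single-conjunct summit, the duplicate component is mandated (D-0017).
set_option linter.dupNamespace false

namespace Summit.HubbardSuperconductivity.HubbardSuperconductivity.Theorems.ComplexGFF

open scoped BigOperators ComplexConjugate
open MeasureTheory
open Literature.MathematicalPhysics.StatisticalMechanics.ComplexGradientGFF4 (Z ev Y D S X w)

variable {n : ℕ}

/-! ### The tilt quadratic form and the tilted perturbation -/

/-- The local quadratic form of the tilt response: `Q_u(z) = u_0 Σ_{j=1}^3 z_j² + 2 z_0 Σ_{j=1}^3 u_j z_j`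
(the first-order term of `𝒜(z + u)` in `u`), so that `Y_u(φ) = Σ_x Q_u(∇φ(x))`. -/
def tiltQ (u z : Fin 4 → ℝ) : ℝ :=
  u 0 * ∑ j : Fin 3, (z j.succ) ^ 2 + 2 * z 0 * ∑ j : Fin 3, u j.succ * z j.succ

/-- The tilted single-site perturbation `𝒦_{g,t}(z) = exp(−i g 𝒜(z) + t Q_u(z)) − 1`
(`= e^{tQ_u(z)}(1 + 𝒦_g(z)) − 1`), real tilt parameter `t`. -/
def tiltK (g : ℝ) (u : Fin 4 → ℝ) (t : ℝ) (z : Fin 4 → ℝ) : ℂ :=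
  Complex.exp (-(Complex.I * ((g * berryVertex z : ℝ) : ℂ)) + ((t * tiltQ u z : ℝ) : ℂ)) - 1

/-- The moments of the real exponential tilt: `M_k(t) = ∫ w_{g,0}(φ) · Y_u(φ)^k · e^{t Y_u(φ)} dφ`. -/
def tiltMoment (n : ℕ) [NeZero n] (g : ℝ) (u : Fin 4 → ℝ) (k : ℕ) (t : ℝ) : ℂ :=
  ∫ φ : (Fin 4 → ZMod n) → ℝ,
    w g 0 φ * (((Y u φ : ℝ) : ℂ) ^ k * Complex.exp ((t : ℂ) * ((Y u φ : ℝ) : ℂ)))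

/-- `Y_u(φ) = Σ_x Q_u(∇φ(x))`. -/
theorem Y_eq_sum_tiltQ [NeZero n] (u : Fin 4 → ℝ) (φ : (Fin 4 → ZMod n) → ℝ) :
    Y u φ = ∑ x : Fin 4 → ZMod n, tiltQ u (fun i => D φ i x) := by
  unfold Y tiltQ
  rfl

/-- `Q_u` is even: `Q_u(−z) = Q_u(z)`. -/
theorem tiltQ_neg (u z : Fin 4 → ℝ) : tiltQ u (-z) = tiltQ u z := by
  unfold tiltQ
  simp only [Pi.neg_apply, neg_sq, mul_neg, Finset.sum_neg_distrib, neg_mul, neg_neg]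

/-- At `t = 0` the tilted perturbation is the model's perturbation: `𝒦_{g,0} = 𝒦_g`. -/
theorem tiltK_zero (g : ℝ) (u : Fin 4 → ℝ) : tiltK g u 0 = pertK g := by
  funext z
  unfold tiltK pertK
  simp

/-- `ι`-symmetry of the tilted perturbation (real tilt): `𝒦_{g,t}(−z) = conj 𝒦_{g,t}(z)`. -/
theorem tiltK_neg (g : ℝ) (u : Fin 4 → ℝ) (t : ℝ) (z : Fin 4 → ℝ) :
    tiltK g u t (-z) = conj (tiltK g u t z) := by
  unfold tiltK
  rw [berryVertex_neg, tiltQ_neg, map_sub, map_one, ← Complex.exp_conj, map_add, map_neg, map_mul,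
    Complex.conj_I, Complex.conj_ofReal, Complex.conj_ofReal]
  congr 2
  push_cast
  ring

/-- `1 + 𝒦_{g,t}(z) = exp(−i g 𝒜(z) + t Q_u(z))`. -/
theorem one_add_tiltK (g : ℝ) (u : Fin 4 → ℝ) (t : ℝ) (z : Fin 4 → ℝ) :
    1 + tiltK g u t z =
      Complex.exp (-(Complex.I * ((g * berryVertex z : ℝ) : ℂ)) + ((t * tiltQ u z : ℝ) : ℂ)) := by
  unfold tiltK
  ring

/-- **The tilted weight factorises over sites:**
`e^{−S_0(φ)} ∏_x (1 + 𝒦_{g,t}(∇φ(x))) = w_{g,0}(φ) · e^{t Y_u(φ)}`. -/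
theorem exp_neg_S_mul_prod_tiltK [NeZero n] (g : ℝ) (u : Fin 4 → ℝ) (t : ℝ) (φ : (Fin 4 → ZMod n) → ℝ) :
    Complex.exp (-((S 0 φ : ℝ) : ℂ)) * ∏ x : Fin 4 → ZMod n, (1 + tiltK g u t (fun i => D φ i x))
      = w g 0 φ * Complex.exp ((t : ℂ) * ((Y u φ : ℝ) : ℂ)) := by
  have h1 : ∑ x : Fin 4 → ZMod n,
      (-(Complex.I * ((g * berryVertex (fun i => D φ i x) : ℝ) : ℂ)) + ((t * tiltQ u (fun i => D φ i x) : ℝ) : ℂ))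
      = -(Complex.I * ((g * X 0 φ : ℝ) : ℂ)) + (t : ℂ) * ((Y u φ : ℝ) : ℂ) := by
    rw [Finset.sum_add_distrib, X_zero_eq_sum_berryVertex, Y_eq_sum_tiltQ]
    push_cast
    rw [Finset.mul_sum, Finset.mul_sum, Finset.mul_sum, ← Finset.sum_neg_distrib]
  simp only [one_add_tiltK]
  rw [← Complex.exp_sum, h1]
  unfold w
  rw [← Complex.exp_add, ← Complex.exp_add]
  congr 1
  push_cast
  ring

/-- **`pertZ n 𝒦_{g,t} = M₀(t)`:** the perturbed partition function of the tilted perturbation is the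
moment generating function of `Y_u` under the complex weight `w_{g,0}`. -/
theorem pertZ_tiltK [NeZero n] (g : ℝ) (u : Fin 4 → ℝ) (t : ℝ) :
    pertZ n (tiltK g u t) = tiltMoment n g u 0 t := by
  unfold pertZ tiltMoment
  refine integral_congr_ae (Filter.Eventually.of_forall (fun φ => ?_))
  simp only [pow_zero, one_mul]
  exact exp_neg_S_mul_prod_tiltK g u t φ

/-- `M₀(0) = Z_n(g,0)`. -/
theorem tiltMoment_zero_zero [NeZero n] (g : ℝ) (u : Fin 4 → ℝ) : tiltMoment n g u 0 0 = Z n g 0 := by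
  rw [← pertZ_tiltK, tiltK_zero, pertZ_pertK]

/-- `⟨Y_u^k⟩_g = M_k(0)/Z_n(g,0)` (both sides carry the same junk value when `Z_n(g,0) = 0`). -/
theorem ev_pow_Y_eq [NeZero n] (g : ℝ) (u : Fin 4 → ℝ) (k : ℕ) :
    ev n g (fun φ => ((Y u φ ^ k : ℝ) : ℂ)) = tiltMoment n g u k 0 / Z n g 0 := by
  unfold ev tiltMoment
  congr 1
  refine integral_congr_ae (Filter.Eventually.of_forall (fun φ => ?_))
  simp only [Complex.ofReal_zero, zero_mul, Complex.exp_zero, mul_one]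
  push_cast
  ring

/-! ### Domination: `|Y_u| ≤ 6‖u‖ S_0`, `S_0^m ≤ (4m)^m e^{S_0/4}` -/

/-- `|Q_u(z)| ≤ 3‖u‖ Σ_i z_i²` (`‖u‖` the sup norm). -/
theorem abs_tiltQ_le (u z : Fin 4 → ℝ) : |tiltQ u z| ≤ 3 * ‖u‖ * ∑ i : Fin 4, (z i) ^ 2 := by
  have hu : ∀ i, |u i| ≤ ‖u‖ := fun i => by
    have h := norm_le_pi_norm u i
    rwa [Real.norm_eq_abs] at h
  have hu0 : 0 ≤ ‖u‖ := norm_nonneg u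
  unfold tiltQ
  have hA : 0 ≤ ∑ j : Fin 3, (z j.succ) ^ 2 := Finset.sum_nonneg (fun j _ => sq_nonneg _)
  have hB : |∑ j : Fin 3, u j.succ * z j.succ| ≤ ‖u‖ * ∑ j : Fin 3, |z j.succ| := by
    refine le_trans (Finset.abs_sum_le_sum_abs _ _) ?_
    rw [Finset.mul_sum]
    refine Finset.sum_le_sum (fun j _ => ?_)
    rw [abs_mul]
    exact mul_le_mul_of_nonneg_right (hu j.succ) (abs_nonneg _)
  have hC : 2 * |z 0| * ∑ j : Fin 3, |z j.succ| ≤ 3 * (z 0) ^ 2 + ∑ j : Fin 3, (z j.succ) ^ 2 := by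
    rw [Finset.mul_sum]
    have h1 : ∀ j : Fin 3, 2 * |z 0| * |z j.succ| ≤ (z 0) ^ 2 + (z j.succ) ^ 2 := fun j => by
      rw [← sq_abs (z 0), ← sq_abs (z j.succ)]
      nlinarith [sq_nonneg (|z 0| - |z j.succ|)]
    calc ∑ j : Fin 3, 2 * |z 0| * |z j.succ| ≤ ∑ j : Fin 3, ((z 0) ^ 2 + (z j.succ) ^ 2) :=
          Finset.sum_le_sum (fun j _ => h1 j)
      _ = 3 * (z 0) ^ 2 + ∑ j : Fin 3, (z j.succ) ^ 2 := by
          rw [Finset.sum_add_distrib]; simp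
  have hsum4 : ∑ i : Fin 4, (z i) ^ 2 = (z 0) ^ 2 + ∑ j : Fin 3, (z j.succ) ^ 2 := by
    rw [Fin.sum_univ_succ]
  calc |u 0 * ∑ j : Fin 3, (z j.succ) ^ 2 + 2 * z 0 * ∑ j : Fin 3, u j.succ * z j.succ|
      ≤ |u 0 * ∑ j : Fin 3, (z j.succ) ^ 2| + |2 * z 0 * ∑ j : Fin 3, u j.succ * z j.succ| :=
        abs_add_le _ _
    _ = |u 0| * ∑ j : Fin 3, (z j.succ) ^ 2 + 2 * |z 0| * |∑ j : Fin 3, u j.succ * z j.succ| := by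
        rw [abs_mul, abs_of_nonneg hA, abs_mul, abs_mul, abs_two]
    _ ≤ ‖u‖ * ∑ j : Fin 3, (z j.succ) ^ 2 + 2 * |z 0| * (‖u‖ * ∑ j : Fin 3, |z j.succ|) := by
        gcongr
        exact hu 0
    _ = ‖u‖ * (∑ j : Fin 3, (z j.succ) ^ 2 + 2 * |z 0| * ∑ j : Fin 3, |z j.succ|) := by ring
    _ ≤ ‖u‖ * (∑ j : Fin 3, (z j.succ) ^ 2 + (3 * (z 0) ^ 2 + ∑ j : Fin 3, (z j.succ) ^ 2)) := by
        gcongr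
    _ ≤ 3 * ‖u‖ * ∑ i : Fin 4, (z i) ^ 2 := by
        rw [hsum4]
        nlinarith [sq_nonneg (z 0), hA]

/-- `|Y_u(φ)| ≤ 6‖u‖ S_0(φ)`. -/
theorem abs_Y_le_norm_mul_S [NeZero n] (u : Fin 4 → ℝ) (φ : (Fin 4 → ZMod n) → ℝ) :
    |Y u φ| ≤ 6 * ‖u‖ * S 0 φ := by
  rw [Y_eq_sum_tiltQ]
  refine le_trans (Finset.abs_sum_le_sum_abs _ _) ?_
  calc ∑ x : Fin 4 → ZMod n, |tiltQ u (fun i => D φ i x)|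
      ≤ ∑ x : Fin 4 → ZMod n, 3 * ‖u‖ * ∑ i : Fin 4, (D φ i x) ^ 2 :=
        Finset.sum_le_sum (fun x _ => abs_tiltQ_le u _)
    _ = 3 * ‖u‖ * ∑ x : Fin 4 → ZMod n, ∑ i : Fin 4, (D φ i x) ^ 2 := by rw [Finset.mul_sum]
    _ ≤ 3 * ‖u‖ * (2 * S 0 φ) :=
        mul_le_mul_of_nonneg_left (sum_sq_D_le_two_S φ) (by positivity)
    _ = 6 * ‖u‖ * S 0 φ := by ring

/-- `‖w_{g,0}(φ)‖ = e^{−S_0(φ)}`. -/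
theorem norm_w_zero [NeZero n] (g : ℝ) (φ : (Fin 4 → ZMod n) → ℝ) : ‖w g 0 φ‖ = Real.exp (-(S 0 φ)) := by
  unfold w
  rw [Complex.norm_exp]
  congr 1
  simp only [Complex.sub_re, Complex.neg_re, Complex.ofReal_re, Complex.mul_re, Complex.I_re,
    Complex.I_im, Complex.ofReal_im, zero_mul, one_mul, zero_sub, sub_neg_eq_add]
  ring

/-- polynomial versus exponential: `s^m ≤ (4m)^m e^{s/4}` for `s ≥ 0`, `m ≥ 1`. -/
theorem pow_le_pow_mul_exp_quarter {s : ℝ} (hs : 0 ≤ s) {m : ℕ} (hm : 1 ≤ m) :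
    s ^ m ≤ (4 * (m : ℝ)) ^ m * Real.exp (s / 4) := by
  have hm0 : (0 : ℝ) < 4 * (m : ℝ) := by positivity
  set y : ℝ := s / (4 * (m : ℝ)) with hy
  have hy0 : 0 ≤ y := by positivity
  have hy1 : y ≤ Real.exp y := by linarith [Real.add_one_le_exp y]
  have hs' : s = 4 * (m : ℝ) * y := by rw [hy]; field_simp
  have hexp : Real.exp y ^ m = Real.exp (s / 4) := by
    rw [← Real.exp_nat_mul, hs']
    congr 1
    field_simp
  calc s ^ m = (4 * (m : ℝ)) ^ m * y ^ m := by rw [hs', mul_pow]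
    _ ≤ (4 * (m : ℝ)) ^ m * Real.exp y ^ m := by
        gcongr
    _ = (4 * (m : ℝ)) ^ m * Real.exp (s / 4) := by rw [hexp]

/-- `|Y_u|^k ≤ (24k‖u‖+1)^k e^{S_0/4}`. -/
theorem pow_abs_Y_le [NeZero n] (u : Fin 4 → ℝ) (φ : (Fin 4 → ZMod n) → ℝ) (k : ℕ) :
    |Y u φ| ^ k ≤ (24 * (k : ℝ) * ‖u‖ + 1) ^ k * Real.exp (S 0 φ / 4) := by
  have hS := S_zero_nonneg φ
  have hu0 : 0 ≤ ‖u‖ := norm_nonneg u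
  rcases Nat.eq_zero_or_pos k with hk | hk
  · subst hk
    simp [Real.one_le_exp_iff.mpr (by positivity : 0 ≤ S 0 φ / 4)]
  · have h1 : |Y u φ| ^ k ≤ (6 * ‖u‖) ^ k * (S 0 φ) ^ k := by
      rw [← mul_pow]
      exact pow_le_pow_left₀ (abs_nonneg _) (abs_Y_le_norm_mul_S u φ) k
    have h2 := pow_le_pow_mul_exp_quarter hS (m := k) hk
    have h3 : (6 * ‖u‖) ^ k * ((4 * (k : ℝ)) ^ k) = (24 * (k : ℝ) * ‖u‖) ^ k := by
      rw [← mul_pow]; ring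
    calc |Y u φ| ^ k ≤ (6 * ‖u‖) ^ k * (S 0 φ) ^ k := h1
      _ ≤ (6 * ‖u‖) ^ k * ((4 * (k : ℝ)) ^ k * Real.exp (S 0 φ / 4)) := by gcongr
      _ = (24 * (k : ℝ) * ‖u‖) ^ k * Real.exp (S 0 φ / 4) := by rw [← mul_assoc, h3]
      _ ≤ (24 * (k : ℝ) * ‖u‖ + 1) ^ k * Real.exp (S 0 φ / 4) := by
          gcongr
          linarith

/-- The radius of the tilt parameter on which the moments are dominated: `t₀(u) = 1/(24(‖u‖+1))`. -/
theorem tiltRadius_pos (u : Fin 4 → ℝ) : (0 : ℝ) < 1 / (24 * (‖u‖ + 1)) := by positivity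

/-- the real tilt is dominated: `e^{xY_u} ≤ e^{S_0/4}` for `|x| ≤ 1/(24(‖u‖+1))`. -/
theorem exp_tilt_le_exp_quarter [NeZero n] (u : Fin 4 → ℝ) (φ : (Fin 4 → ZMod n) → ℝ) {x : ℝ}
    (hx : |x| ≤ 1 / (24 * (‖u‖ + 1))) : Real.exp (x * Y u φ) ≤ Real.exp (S 0 φ / 4) := by
  apply Real.exp_le_exp.mpr
  have hS := S_zero_nonneg φ
  have hu0 : 0 ≤ ‖u‖ := norm_nonneg u
  have h1 : x * Y u φ ≤ |x| * |Y u φ| := by rw [← abs_mul]; exact le_abs_self _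
  have h2 : |x| * |Y u φ| ≤ 1 / (24 * (‖u‖ + 1)) * (6 * ‖u‖ * S 0 φ) :=
    mul_le_mul hx (abs_Y_le_norm_mul_S u φ) (abs_nonneg _) (by positivity)
  have h3 : 1 / (24 * (‖u‖ + 1)) * (6 * ‖u‖ * S 0 φ) ≤ S 0 φ / 4 := by
    rw [div_mul_eq_mul_div, one_mul, div_le_iff₀ (by positivity)]
    nlinarith [mul_nonneg hu0 hS]
  linarith

/-- **Pointwise domination of the tilt integrands:** for `|x| ≤ 1/(24(‖u‖+1))`,
`‖w_{g,0} · Y_u^k · e^{xY_u}‖ ≤ (24k‖u‖+1)^k · e^{−S_0/2}`. -/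
theorem norm_tiltIntegrand_le [NeZero n] (g : ℝ) (u : Fin 4 → ℝ) (k : ℕ) {x : ℝ}
    (hx : |x| ≤ 1 / (24 * (‖u‖ + 1))) (φ : (Fin 4 → ZMod n) → ℝ) :
    ‖w g 0 φ * (((Y u φ : ℝ) : ℂ) ^ k * Complex.exp ((x : ℂ) * ((Y u φ : ℝ) : ℂ)))‖
      ≤ (24 * (k : ℝ) * ‖u‖ + 1) ^ k * Real.exp (-(S 0 φ) / 2) := by
  rw [norm_mul, norm_mul, norm_w_zero, norm_pow, Complex.norm_real, Real.norm_eq_abs, Complex.norm_exp]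
  have hre : ((x : ℂ) * ((Y u φ : ℝ) : ℂ)).re = x * Y u φ := by simp
  rw [hre]
  have h1 := pow_abs_Y_le u φ k
  have h2 := exp_tilt_le_exp_quarter u φ hx
  have hS := S_zero_nonneg φ
  calc Real.exp (-(S 0 φ)) * (|Y u φ| ^ k * Real.exp (x * Y u φ))
      ≤ Real.exp (-(S 0 φ)) * (((24 * (k : ℝ) * ‖u‖ + 1) ^ k * Real.exp (S 0 φ / 4)) * Real.exp (S 0 φ / 4)) := by
        gcongr
    _ = (24 * (k : ℝ) * ‖u‖ + 1) ^ k * Real.exp (-(S 0 φ) / 2) := by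
        have : Real.exp (-(S 0 φ)) * Real.exp (S 0 φ / 4) * Real.exp (S 0 φ / 4) = Real.exp (-(S 0 φ) / 2) := by
          rw [← Real.exp_add, ← Real.exp_add]; congr 1; ring
        rw [← this]; ring

/-! ### Differentiability of the moments under the integral sign -/

/-- the tilt integrands are continuous in the field. -/
theorem continuous_tiltIntegrand [NeZero n] (g : ℝ) (u : Fin 4 → ℝ) (k : ℕ) (x : ℝ) :
    Continuous (fun φ : (Fin 4 → ZMod n) → ℝ =>
      w g 0 φ * (((Y u φ : ℝ) : ℂ) ^ k * Complex.exp ((x : ℂ) * ((Y u φ : ℝ) : ℂ)))) := by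
  unfold w Y S X D
  fun_prop

/-- the tilt integrands are integrable for `|x| ≤ 1/(24(‖u‖+1))`. -/
theorem integrable_tiltIntegrand [NeZero n] (g : ℝ) (u : Fin 4 → ℝ) (k : ℕ) {x : ℝ}
    (hx : |x| ≤ 1 / (24 * (‖u‖ + 1))) :
    Integrable (fun φ : (Fin 4 → ZMod n) → ℝ =>
      w g 0 φ * (((Y u φ : ℝ) : ℂ) ^ k * Complex.exp ((x : ℂ) * ((Y u φ : ℝ) : ℂ)))) := by
  refine ((integrable_exp_neg_half_S n).const_mul ((24 * (k : ℝ) * ‖u‖ + 1) ^ k)).mono'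
    (continuous_tiltIntegrand g u k x).aestronglyMeasurable
    (Filter.Eventually.of_forall (fun φ => norm_tiltIntegrand_le g u k hx φ))

/-- **`M_k' = M_{k+1}` on `|t| < 1/(24(‖u‖+1))`** (dominated differentiation under the integral sign). -/
theorem hasDerivAt_tiltMoment [NeZero n] (g : ℝ) (u : Fin 4 → ℝ) (k : ℕ) {t : ℝ}
    (ht : |t| < 1 / (24 * (‖u‖ + 1))) :
    HasDerivAt (tiltMoment n g u k) (tiltMoment n g u (k + 1) t) t := by
  set ε₀ : ℝ := 1 / (24 * (‖u‖ + 1)) with hε₀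
  have hball : Metric.ball (0 : ℝ) ε₀ ∈ nhds t :=
    Metric.isOpen_ball.mem_nhds (by simpa [Metric.mem_ball, dist_zero_right] using ht)
  have hmem : ∀ x ∈ Metric.ball (0 : ℝ) ε₀, |x| ≤ ε₀ := fun x hx => by
    have := Metric.mem_ball.mp hx
    rw [dist_zero_right, Real.norm_eq_abs] at this
    exact this.le
  have hF_meas : ∀ x : ℝ, AEStronglyMeasurable (fun φ : (Fin 4 → ZMod n) → ℝ =>
      w g 0 φ * (((Y u φ : ℝ) : ℂ) ^ k * Complex.exp ((x : ℂ) * ((Y u φ : ℝ) : ℂ)))) volume := fun x =>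
    (continuous_tiltIntegrand g u k x).aestronglyMeasurable
  have hF_int := integrable_tiltIntegrand (n := n) g u k ht.le
  have hF'_meas : AEStronglyMeasurable (fun φ : (Fin 4 → ZMod n) → ℝ =>
      w g 0 φ * (((Y u φ : ℝ) : ℂ) ^ (k + 1) * Complex.exp ((t : ℂ) * ((Y u φ : ℝ) : ℂ)))) volume :=
    (continuous_tiltIntegrand g u (k + 1) t).aestronglyMeasurable
  have hb_int : Integrable (fun φ : (Fin 4 → ZMod n) → ℝ =>
      (24 * ((k + 1 : ℕ) : ℝ) * ‖u‖ + 1) ^ (k + 1) * Real.exp (-(S 0 φ) / 2)) :=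
    (integrable_exp_neg_half_S n).const_mul _
  have h_bound : ∀ᵐ φ : (Fin 4 → ZMod n) → ℝ ∂volume, ∀ x ∈ Metric.ball (0 : ℝ) ε₀,
      ‖w g 0 φ * (((Y u φ : ℝ) : ℂ) ^ (k + 1) * Complex.exp ((x : ℂ) * ((Y u φ : ℝ) : ℂ)))‖
        ≤ (24 * ((k + 1 : ℕ) : ℝ) * ‖u‖ + 1) ^ (k + 1) * Real.exp (-(S 0 φ) / 2) :=
    Filter.Eventually.of_forall (fun φ x hx => norm_tiltIntegrand_le g u (k + 1) (hmem x hx) φ)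
  have h_diff : ∀ᵐ φ : (Fin 4 → ZMod n) → ℝ ∂volume, ∀ x ∈ Metric.ball (0 : ℝ) ε₀,
      HasDerivAt (fun s : ℝ => w g 0 φ * (((Y u φ : ℝ) : ℂ) ^ k * Complex.exp ((s : ℂ) * ((Y u φ : ℝ) : ℂ))))
        (w g 0 φ * (((Y u φ : ℝ) : ℂ) ^ (k + 1) * Complex.exp ((x : ℂ) * ((Y u φ : ℝ) : ℂ)))) x := by
    refine Filter.Eventually.of_forall (fun φ x _ => ?_)
    have h1 : HasDerivAt (fun s : ℝ => (s : ℂ) * ((Y u φ : ℝ) : ℂ)) (1 * ((Y u φ : ℝ) : ℂ)) x :=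
      Complex.ofRealCLM.hasDerivAt.mul_const _
    have h2 := ((h1.cexp).const_mul (((Y u φ : ℝ) : ℂ) ^ k)).const_mul (w g 0 φ)
    refine h2.congr_deriv ?_
    ring
  exact (hasDerivAt_integral_of_dominated_loc_of_deriv_le hball
    (Filter.Eventually.of_forall hF_meas) hF_int hF'_meas h_bound hb_int h_diff).2

/-- the moments are continuous at every `|t| < 1/(24(‖u‖+1))`. -/
theorem continuousAt_tiltMoment [NeZero n] (g : ℝ) (u : Fin 4 → ℝ) (k : ℕ) {t : ℝ}
    (ht : |t| < 1 / (24 * (‖u‖ + 1))) : ContinuousAt (tiltMoment n g u k) t :=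
  (hasDerivAt_tiltMoment g u k ht).continuousAt

/-! ### The second cumulant is the derivative of the tilted mean -/

/-- **The second cumulant as a first derivative** (fixed volume): if `Z_n(g,0) ≠ 0`, the tilted mean
`t ↦ ⟨Y_u⟩_{g,t} = M₁(t)/M₀(t)` is differentiable at `t = 0` with derivative `⟨Y_u²⟩_g − ⟨Y_u⟩_g²`.
[cite: AdamsBuchholzKoteckyMuller2019, Thm 2.2] -/
theorem hasDerivAt_tiltMean [NeZero n] (g : ℝ) (u : Fin 4 → ℝ) (hZ : Z n g 0 ≠ 0) :
    HasDerivAt (fun t : ℝ => tiltMoment n g u 1 t / tiltMoment n g u 0 t)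
      (ev n g (fun φ => ((Y u φ ^ 2 : ℝ) : ℂ)) - (ev n g (fun φ => ((Y u φ : ℝ) : ℂ))) ^ 2) 0 := by
  have h0 := tiltRadius_pos u
  have h00 : |(0 : ℝ)| < 1 / (24 * (‖u‖ + 1)) := by rwa [abs_zero]
  have hM0 := hasDerivAt_tiltMoment (n := n) g u 0 h00
  have hM1 := hasDerivAt_tiltMoment (n := n) g u 1 h00
  have hne : tiltMoment n g u 0 0 ≠ 0 := by rwa [tiltMoment_zero_zero]
  have h := hM1.div hM0 hne
  have e1 : ev n g (fun φ => ((Y u φ : ℝ) : ℂ)) = tiltMoment n g u 1 0 / Z n g 0 := by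
    rw [← ev_pow_Y_eq]; simp
  have e2 : ev n g (fun φ => ((Y u φ ^ 2 : ℝ) : ℂ)) = tiltMoment n g u 2 0 / Z n g 0 := ev_pow_Y_eq g u 2
  rw [e1, e2]
  refine h.congr_deriv ?_
  rw [tiltMoment_zero_zero]
  field_simp

/-- **The tilted mean is `|Λ|` times a one-point function:** for every `t`,
`M₁(t) = ∫ (Σ_x Q_u(∇φ(x))) · e^{−S_0(φ)} ∏_y (1 + 𝒦_{g,t}(∇φ(y))) dφ`, i.e.
`M₁(t)/M₀(t) = |Λ| · onePoint n 𝒦_{g,t} Q_u` (`onePoint_tiltK`). -/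
theorem tiltMoment_one_eq [NeZero n] (g : ℝ) (u : Fin 4 → ℝ) (t : ℝ) :
    tiltMoment n g u 1 t =
      ∫ φ : (Fin 4 → ZMod n) → ℝ,
        (∑ x : Fin 4 → ZMod n, ((tiltQ u (fun i => D φ i x) : ℝ) : ℂ)) *
          (Complex.exp (-((S 0 φ : ℝ) : ℂ)) * ∏ x : Fin 4 → ZMod n, (1 + tiltK g u t (fun i => D φ i x))) := by
  unfold tiltMoment
  refine integral_congr_ae (Filter.Eventually.of_forall (fun φ => ?_))
  beta_reduce
  rw [exp_neg_S_mul_prod_tiltK, pow_one, Y_eq_sum_tiltQ]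
  push_cast
  ring

/-- `⟨Y_u⟩_{g,t} = M₁(t)/M₀(t) = |Λ| · onePoint n 𝒦_{g,t} Q_u` (with `Q_u` read as a complex observable). -/
theorem onePoint_tiltK [NeZero n] (g : ℝ) (u : Fin 4 → ℝ) (t : ℝ) :
    (Fintype.card (Fin 4 → ZMod n) : ℂ) * onePoint n (tiltK g u t) (fun z => ((tiltQ u z : ℝ) : ℂ))
      = tiltMoment n g u 1 t / tiltMoment n g u 0 t := by
  unfold onePoint
  beta_reduce
  rw [← tiltMoment_one_eq, pertZ_tiltK]
  have hcard : (Fintype.card (Fin 4 → ZMod n) : ℂ) ≠ 0 := by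
    exact_mod_cast Fintype.card_ne_zero
  rw [← mul_div_assoc, mul_div_mul_left _ _ hcard]

end Summit.HubbardSuperconductivity.HubbardSuperconductivity.Theorems.ComplexGFF

end
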